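import Summits.CriticalPhenomena.PercolationContinuityZ3.Theorems.PercNearOneGluingNoHeavyLowerTailKNClusterPropertyForms
import Literature.Probability.LatticeModels.ProdBernoulliClusterLocality
import HarnessLib

/-!
# Kozma–Nitzan's Conjecture 4 "for any graph G": an arbitrary finite graph `G = (Fin n, E)` with edge probabilities, and
# the LITERAL two-argument monotone cluster properties `f(v, ω)` of §5.1 relative to `G`

Support file (`--supports stmt-CriticalPhenomena-4575`), cell perc-kn (req609-KN), lead `perc-kn-lead` (gen 4).  No definitions,
no named facts, no sorries; standard axioms.  Requested by the cell's faithfulness audits (`AUDIT-lead-g2.md` errata 1,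
`AUDIT-r2-g3…g6.md` D2/R-ext): formalize, in the tree, the "elementary" reduction from an arbitrary finite graph to the tree's
complete-graph-with-weights setting.

Kozma–Nitzan (arXiv:2401.12397) state Conjecture 4 (p. 32) for "any graph `G`, any monotone cluster property `f`, any `A ⊂ G`
and any `0 ∈ G`", where (§5.1, p. 31–32) `f : G × {0,1}^{E(G)} → ℝ`, (1) `f(v, ω)` depends only on `C_ω(v)` and is increasing
in it, (2) `{v, w} ∈ ω ⇒ f(v, ω) = f(w, ω)`.  The tree states everything on the vertex set `Fin n` with a weight `w(e) ∈ [0,1]`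
on EVERY pair and a ONE-argument functional `F(C_ω(v))` of the cluster (`PreFKGSurplus.kn_conj4_min_clusterProperty`,
`Q7Psi.kn_conj4_designated_clusterProperty`, file F11).  A finite graph `G = (Fin n, E)` with probabilities `p_e` is the weight
`w = p` on `E`, `w = 0` off `E` (a weight-0 pair is almost surely closed, `prodBernoulli_ae_forall_notMem`); but relative to `G`
the class of admissible `f` is LARGER than on `K_n`, because (1)+(2) are only imposed on configurations `ω ⊆ E`.  This file
proves that nothing is lost: every such `f` is represented on configurations inside `E` by a set functional increasing along
nonempty vertex sets (`KNLiteral.exists_setFunctional`, the max-extension `T ↦ max {f(u, E ∩ K[S']) : u ∈ S' ⊆ T}`), whence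
* `PreFKGSurplus.kn_conj4_min_graph` — **Conjecture 4 exactly as printed, on an arbitrary finite graph with edge probabilities,
  for the literal two-argument class relative to that graph**: `min_{a∈A} E[f(a,·); o ↔ A] ≤ E[f(o,·); o ↔ A]`;
* `PreFKGSurplus.kn_conj4_graph` — the same in the `∃ a ∈ A` shape;
* `Q7Psi.kn_conj4_designated_graph` — the pre-FKG inequality at EVERY minimiser `c ∈ A` of `a ↦ E f(a,·)` (Theorem KN (ii)) in the
  same generality.
[cite: KozmaNitzan2024, §5.1 (p. 31–32), Conj. 4 (p. 32), §2.1 (p. 4)]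
-/

noncomputable section

namespace Summit.CriticalPhenomena.PercolationContinuityZ3.Theorems

open MeasureTheory Set
open Literature.Probability.LatticeModels (prodBernoulli prodBernoulli_ae_forall_notMem)
open Literature.Probability.Percolation
open scoped Classical

namespace KNLiteral

variable {n : ℕ}

/-! ### Cluster combinatorics inside a vertex set -/

/-- A configuration all of whose pairs lie inside `S` has clusters inside `S`. [cite: KozmaNitzan2024, §2.1 (p. 4)] -/
theorem openCluster_subset_of_forall_mem {S : Set (Fin n)} {ω : BondConfig (Fin n)} (hω : ∀ e ∈ ω, ∀ x ∈ e, x ∈ S)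
    {u : Fin n} (hu : u ∈ S) : openCluster ω u ⊆ S := by
  intro y hy
  change (openGraph ω).Reachable u y at hy
  rw [SimpleGraph.reachable_iff_reflTransGen] at hy
  induction hy with
  | refl => exact hu
  | tail _ hbc _ => exact hω _ ((openGraph_adj _ _ _).1 hbc).1 _ (Sym2.mem_mk_right _ _)

/-- For `ω ⊆ E`, the cluster `C = C_ω(v)` is reached from `v` inside the configuration `E ∩ K[C]` (all pairs of `E` inside `C`).
[cite: KozmaNitzan2024, §2.1 (p. 4)] -/
theorem openCluster_subset_openCluster_inter {E : Set (Sym2 (Fin n))} {ω : BondConfig (Fin n)} (hω : ω ⊆ E) (v : Fin n) :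
    openCluster ω v ⊆ openCluster (E ∩ {e | ∀ x ∈ e, x ∈ openCluster ω v}) v := by
  intro y hy
  change (openGraph ω).Reachable v y at hy
  change (openGraph (E ∩ {e | ∀ x ∈ e, x ∈ openCluster ω v})).Reachable v y
  rw [SimpleGraph.reachable_iff_reflTransGen] at hy ⊢
  induction hy with
  | refl => exact Relation.ReflTransGen.refl
  | tail hab hbc ih =>
    obtain ⟨hmem, hne⟩ := (openGraph_adj _ _ _).1 hbc
    have hb : _ ∈ openCluster ω v := (SimpleGraph.reachable_iff_reflTransGen _ _).2 hab
    have hc : _ ∈ openCluster ω v := (SimpleGraph.reachable_iff_reflTransGen _ _).2 (hab.tail hbc)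
    refine ih.tail ((openGraph_adj _ _ _).2 ⟨⟨hω hmem, ?_⟩, hne⟩)
    intro z hz
    rcases Sym2.mem_iff.1 hz with rfl | rfl
    · exact hb
    · exact hc

/-- Requirement (2) iterated along an open path of a configuration inside `E`: `f(·, ω)` is constant on clusters.
[cite: KozmaNitzan2024, §5.1 (2) (p. 32)] -/
theorem apply_eq_of_reachable {E : Set (Sym2 (Fin n))} {f : Fin n → BondConfig (Fin n) → ℝ}
    (h2 : ∀ (v u : Fin n) (ω : BondConfig (Fin n)), ω ⊆ E → v ≠ u → s(v, u) ∈ ω → f v ω = f u ω)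
    {ω : BondConfig (Fin n)} (hω : ω ⊆ E) {v u : Fin n} (h : (openGraph ω).Reachable v u) : f v ω = f u ω := by
  rw [SimpleGraph.reachable_iff_reflTransGen] at h
  induction h with
  | refl => rfl
  | tail _ hbc ih =>
    obtain ⟨hmem, hne⟩ := (openGraph_adj _ _ _).1 hbc
    exact ih.trans (h2 _ _ _ hω hne hmem)

/-! ### The max-extension of a literal monotone cluster property -/

/-- The value set `{f(u, E ∩ K[S']) : u ∈ S' ⊆ T}` is finite. -/
theorem vals_finite (E : Set (Sym2 (Fin n))) (f : Fin n → BondConfig (Fin n) → ℝ) (T : Set (Fin n)) :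
    {x : ℝ | ∃ (S' : Set (Fin n)) (u : Fin n), u ∈ S' ∧ S' ⊆ T ∧ x = f u (E ∩ {e | ∀ y ∈ e, y ∈ S'})}.Finite := by
  refine (Set.finite_range (fun p : Set (Fin n) × Fin n => f p.2 (E ∩ {e | ∀ y ∈ e, y ∈ p.1}))).subset ?_
  rintro x ⟨S', u, -, -, rfl⟩
  exact ⟨(S', u), rfl⟩

/-- … nonempty for nonempty `T`. -/
theorem vals_nonempty (E : Set (Sym2 (Fin n))) (f : Fin n → BondConfig (Fin n) → ℝ) {T : Set (Fin n)} (hT : T.Nonempty) :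
    {x : ℝ | ∃ (S' : Set (Fin n)) (u : Fin n), u ∈ S' ∧ S' ⊆ T ∧ x = f u (E ∩ {e | ∀ y ∈ e, y ∈ S'})}.Nonempty :=
  ⟨_, {hT.some}, hT.some, mem_singleton _, singleton_subset_iff.2 hT.some_mem, rfl⟩

/-- … and monotone in `T`. -/
theorem vals_mono (E : Set (Sym2 (Fin n))) (f : Fin n → BondConfig (Fin n) → ℝ) {T T' : Set (Fin n)} (h : T ⊆ T') :
    {x : ℝ | ∃ (S' : Set (Fin n)) (u : Fin n), u ∈ S' ∧ S' ⊆ T ∧ x = f u (E ∩ {e | ∀ y ∈ e, y ∈ S'})} ⊆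
      {x : ℝ | ∃ (S' : Set (Fin n)) (u : Fin n), u ∈ S' ∧ S' ⊆ T' ∧ x = f u (E ∩ {e | ∀ y ∈ e, y ∈ S'})} := by
  rintro x ⟨S', u, hu, hS', rfl⟩
  exact ⟨S', u, hu, hS'.trans h, rfl⟩

/-- **A literal monotone cluster property relative to `G = (Fin n, E)` is a set functional increasing along nonempty vertex
sets, on every configuration inside `E`.**  For `f : vertex → configuration → ℝ` with §5.1 (1) (`f(v, ·)` increasing in
`C_·(v)`, hence a function of it) and (2) (`f(v, ω) = f(u, ω)` across an open edge) imposed for configurations `⊆ E` only, the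
max-extension `F(T) = max {f(u, E ∩ K[S']) : u ∈ S' ⊆ T}` is increasing along nonempty sets and `f(v, ω) = F(C_ω(v))` for all
`ω ⊆ E`. [cite: KozmaNitzan2024, §5.1 (1)–(2) (p. 31–32)] -/
theorem exists_setFunctional (E : Set (Sym2 (Fin n))) (f : Fin n → BondConfig (Fin n) → ℝ)
    (h1 : ∀ (v : Fin n) (ω ξ : BondConfig (Fin n)), ω ⊆ E → ξ ⊆ E → openCluster ω v ⊆ openCluster ξ v → f v ω ≤ f v ξ)
    (h2 : ∀ (v u : Fin n) (ω : BondConfig (Fin n)), ω ⊆ E → v ≠ u → s(v, u) ∈ ω → f v ω = f u ω) :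
    ∃ F : Set (Fin n) → ℝ, (∀ S T : Set (Fin n), S.Nonempty → S ⊆ T → F S ≤ F T) ∧
      ∀ (ω : BondConfig (Fin n)), ω ⊆ E → ∀ v : Fin n, f v ω = F (openCluster ω v) := by
  refine ⟨fun T => sSup {x : ℝ | ∃ (S' : Set (Fin n)) (u : Fin n), u ∈ S' ∧ S' ⊆ T ∧ x = f u (E ∩ {e | ∀ y ∈ e, y ∈ S'})},
    fun S T hS hST => csSup_le_csSup (vals_finite E f T).bddAbove (vals_nonempty E f hS) (vals_mono E f hST), ?_⟩
  intro ω hω v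
  have hv : v ∈ openCluster ω v := mem_openCluster_self ω v
  apply le_antisymm
  · -- `f v ω ≤ f v (E ∩ K[C]) ∈ vals C`
    refine le_trans ?_ (le_csSup (vals_finite E f _).bddAbove ⟨openCluster ω v, v, hv, subset_rfl, rfl⟩)
    exact h1 v _ _ hω inter_subset_left (openCluster_subset_openCluster_inter hω v)
  · refine csSup_le (vals_nonempty E f ⟨v, hv⟩) ?_
    rintro x ⟨S', u, hu, hS', rfl⟩
    have hvu : (openGraph ω).Reachable v u := hS' hu
    calc f u (E ∩ {e | ∀ y ∈ e, y ∈ S'}) ≤ f u ω := by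
          refine h1 u _ _ inter_subset_left hω ?_
          rw [← KNPreFKG.openCluster_eq_of_reachable hvu]
          exact (openCluster_subset_of_forall_mem (fun e he => he.2) hu).trans hS'
      _ = f v ω := (apply_eq_of_reachable h2 hω hvu).symm

/-- On a graph `G = (Fin n, E)` realised as weights vanishing off `E`, the configuration lies inside `E` almost surely, so a
literal monotone cluster property is a.s. its set functional evaluated at the cluster. [cite: KozmaNitzan2024, §2.1 (p. 4)] -/
theorem ae_apply_eq {E : Set (Sym2 (Fin n))} (w : Sym2 (Fin n) → unitInterval) (hw : ∀ e ∉ E, w e = 0)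
    {f : Fin n → BondConfig (Fin n) → ℝ} {F : Set (Fin n) → ℝ}
    (hF : ∀ (ω : BondConfig (Fin n)), ω ⊆ E → ∀ v : Fin n, f v ω = F (openCluster ω v)) (x : Fin n) :
    (fun ω => f x ω) =ᵐ[prodBernoulli w] fun ω => F (openCluster ω x) := by
  have hae : ∀ᵐ ω ∂prodBernoulli w, ∀ e ∈ Eᶜ, e ∉ ω :=
    prodBernoulli_ae_forall_notMem w (Set.to_countable _) fun e he => hw e he
  filter_upwards [hae] with ω hω
  have hωE : ω ⊆ E := fun e he => by
    by_contra h
    exact hω e h he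
  exact hF ω hωE x

end KNLiteral

namespace PreFKGSurplus

/-- **KOZMA–NITZAN'S CONJECTURE 4 EXACTLY AS PRINTED ("for any graph `G`, any monotone cluster property `f`, any `A ⊂ G` and any
`0 ∈ G`"), `min`-form.**  For an arbitrary finite graph `G = (Fin n, E)` with edge probabilities `w|_E` (weights vanishing off
`E`), every `f : vertex → configuration → ℝ` satisfying §5.1 (1)+(2) on the configurations of `G` (those `⊆ E`), every nonempty
`A` and every `o`:  `min_{a∈A} E[f(a,·); o ↔ A] ≤ E[f(o,·); o ↔ A]`.  (`PreFKGSurplus.kn_conj4_min_clusterProperty` at the set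
functional of `KNLiteral.exists_setFunctional`, a.s. equal to `f`.) [cite: KozmaNitzan2024, Conj. 4 (p. 32), §5.1 (p. 31–32)] -/
theorem kn_conj4_min_graph {n : ℕ} (E : Set (Sym2 (Fin n))) (w : Sym2 (Fin n) → unitInterval) (hw : ∀ e ∉ E, w e = 0)
    (A : Finset (Fin n)) (hA : A.Nonempty) (o : Fin n) (f : Fin n → BondConfig (Fin n) → ℝ)
    (h1 : ∀ (v : Fin n) (ω ξ : BondConfig (Fin n)), ω ⊆ E → ξ ⊆ E → openCluster ω v ⊆ openCluster ξ v → f v ω ≤ f v ξ)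
    (h2 : ∀ (v u : Fin n) (ω : BondConfig (Fin n)), ω ⊆ E → v ≠ u → s(v, u) ∈ ω → f v ω = f u ω) :
    A.inf' hA (fun a => ∫ ω in ⋃ a' ∈ A, openConn o a', f a ω ∂(prodBernoulli w)) ≤
      ∫ ω in ⋃ a' ∈ A, openConn o a', f o ω ∂(prodBernoulli w) := by
  obtain ⟨F, hFmono, hF⟩ := KNLiteral.exists_setFunctional E f h1 h2
  have hint : ∀ x : Fin n, ∫ ω in ⋃ a' ∈ A, openConn o a', f x ω ∂(prodBernoulli w) =
      ∫ ω in ⋃ a' ∈ A, openConn o a', F (openCluster ω x) ∂(prodBernoulli w) :=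
    fun x => integral_congr_ae (ae_restrict_of_ae (KNLiteral.ae_apply_eq w hw hF x))
  have hcongr : (fun a => ∫ ω in ⋃ a' ∈ A, openConn o a', f a ω ∂(prodBernoulli w)) =
      fun a => ∫ ω in ⋃ a' ∈ A, openConn o a', F (openCluster ω a) ∂(prodBernoulli w) := funext hint
  rw [hcongr, hint o]
  exact kn_conj4_min_clusterProperty w A hA o F hFmono

/-- **Kozma–Nitzan's Conjecture 4 on an arbitrary finite graph, literal two-argument class, `∃ a ∈ A` shape.**
[cite: KozmaNitzan2024, Conj. 4 (p. 32), §5.1 (p. 31–32)] -/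
theorem kn_conj4_graph {n : ℕ} (E : Set (Sym2 (Fin n))) (w : Sym2 (Fin n) → unitInterval) (hw : ∀ e ∉ E, w e = 0)
    (A : Finset (Fin n)) (o : Fin n) (f : Fin n → BondConfig (Fin n) → ℝ)
    (h1 : ∀ (v : Fin n) (ω ξ : BondConfig (Fin n)), ω ⊆ E → ξ ⊆ E → openCluster ω v ⊆ openCluster ξ v → f v ω ≤ f v ξ)
    (h2 : ∀ (v u : Fin n) (ω : BondConfig (Fin n)), ω ⊆ E → v ≠ u → s(v, u) ∈ ω → f v ω = f u ω) (hA : A.Nonempty) :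
    ∃ a ∈ A, ∫ ω in ⋃ a' ∈ A, openConn o a', f a ω ∂(prodBernoulli w) ≤
      ∫ ω in ⋃ a' ∈ A, openConn o a', f o ω ∂(prodBernoulli w) := by
  obtain ⟨a, ha, hmin⟩ := Finset.exists_mem_eq_inf' hA (fun a => ∫ ω in ⋃ a' ∈ A, openConn o a', f a ω ∂(prodBernoulli w))
  exact ⟨a, ha, hmin ▸ kn_conj4_min_graph E w hw A hA o f h1 h2⟩

end PreFKGSurplus

namespace Q7Psi

/-- **The pre-FKG inequality at every minimiser (Theorem KN (ii)) on an arbitrary finite graph, literal two-argument class.**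
For `G = (Fin n, E)` with edge probabilities `w|_E` (weights vanishing off `E`), `f` satisfying §5.1 (1)+(2) on configurations
`⊆ E`, and `c ∈ A` minimising `a ↦ E f(a,·)` over `A`:  `E[f(c,·); o ↔ A] ≤ E[f(o,·); o ↔ A]`.
(`Q7Psi.kn_conj4_designated_clusterProperty` at the set functional of `KNLiteral.exists_setFunctional`.)
[cite: KozmaNitzan2024, Conj. 4 (p. 32), §5.1 (p. 31–32), Question 7 (p. 36)] -/
theorem kn_conj4_designated_graph {n : ℕ} (E : Set (Sym2 (Fin n))) (w : Sym2 (Fin n) → unitInterval) (hw : ∀ e ∉ E, w e = 0)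
    (A : Finset (Fin n)) (o c : Fin n) (f : Fin n → BondConfig (Fin n) → ℝ)
    (h1 : ∀ (v : Fin n) (ω ξ : BondConfig (Fin n)), ω ⊆ E → ξ ⊆ E → openCluster ω v ⊆ openCluster ξ v → f v ω ≤ f v ξ)
    (h2 : ∀ (v u : Fin n) (ω : BondConfig (Fin n)), ω ⊆ E → v ≠ u → s(v, u) ∈ ω → f v ω = f u ω) (hcA : c ∈ A)
    (hcmin : ∀ a ∈ A, ∫ ω, f c ω ∂(prodBernoulli w) ≤ ∫ ω, f a ω ∂(prodBernoulli w)) :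
    ∫ ω in ⋃ a ∈ A, openConn o a, f c ω ∂(prodBernoulli w) ≤
      ∫ ω in ⋃ a ∈ A, openConn o a, f o ω ∂(prodBernoulli w) := by
  obtain ⟨F, hFmono, hF⟩ := KNLiteral.exists_setFunctional E f h1 h2
  have hint : ∀ x : Fin n, ∫ ω in ⋃ a ∈ A, openConn o a, f x ω ∂(prodBernoulli w) =
      ∫ ω in ⋃ a ∈ A, openConn o a, F (openCluster ω x) ∂(prodBernoulli w) :=
    fun x => integral_congr_ae (ae_restrict_of_ae (KNLiteral.ae_apply_eq w hw hF x))
  have hint0 : ∀ x : Fin n, ∫ ω, f x ω ∂(prodBernoulli w) = ∫ ω, F (openCluster ω x) ∂(prodBernoulli w) :=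
    fun x => integral_congr_ae (KNLiteral.ae_apply_eq w hw hF x)
  have hcmin' : ∀ a ∈ A, ∫ ω, F (openCluster ω c) ∂(prodBernoulli w) ≤ ∫ ω, F (openCluster ω a) ∂(prodBernoulli w) :=
    fun a ha => hint0 c ▸ hint0 a ▸ hcmin a ha
  rw [hint c, hint o]
  exact kn_conj4_designated_clusterProperty w A o c F hFmono hcA hcmin'

end Q7Psi

/-- Sanity / non-vacuity: on the complete graph (`E = univ`, arbitrary weights) the hypotheses are KN's plain two-argument class
on `K_n`, so `PreFKGSurplus.kn_conj4_min_graph` contains Conjecture 4 for every literal `f(v, ω)` on `K_n`. -/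
example {n : ℕ} (w : Sym2 (Fin n) → unitInterval) (A : Finset (Fin n)) (hA : A.Nonempty) (o : Fin n)
    (f : Fin n → BondConfig (Fin n) → ℝ)
    (h1 : ∀ (v : Fin n) (ω ξ : BondConfig (Fin n)), openCluster ω v ⊆ openCluster ξ v → f v ω ≤ f v ξ)
    (h2 : ∀ (v u : Fin n) (ω : BondConfig (Fin n)), v ≠ u → s(v, u) ∈ ω → f v ω = f u ω) :
    A.inf' hA (fun a => ∫ ω in ⋃ a' ∈ A, openConn o a', f a ω ∂(prodBernoulli w)) ≤
      ∫ ω in ⋃ a' ∈ A, openConn o a', f o ω ∂(prodBernoulli w) :=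
  PreFKGSurplus.kn_conj4_min_graph univ w (fun e he => absurd (mem_univ e) he) A hA o f
    (fun v ω ξ _ _ h => h1 v ω ξ h) (fun v u ω _ hne h => h2 v u ω hne h)

/-- Sanity / non-vacuity: the tree's one-argument cluster functionals `F(C_ω(v))` (increasing along nonempty sets) are literal
monotone cluster properties relative to every `G`, so the class of this file contains that of file F11. -/
example {n : ℕ} (E : Set (Sym2 (Fin n))) (F : Set (Fin n) → ℝ) (hF : ∀ S T : Set (Fin n), S.Nonempty → S ⊆ T → F S ≤ F T) :
    (∀ (v : Fin n) (ω ξ : BondConfig (Fin n)), ω ⊆ E → ξ ⊆ E → openCluster ω v ⊆ openCluster ξ v →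
        F (openCluster ω v) ≤ F (openCluster ξ v)) ∧
      ∀ (v u : Fin n) (ω : BondConfig (Fin n)), ω ⊆ E → v ≠ u → s(v, u) ∈ ω → F (openCluster ω v) = F (openCluster ω u) :=
  ⟨fun v ω ξ _ _ h => hF _ _ ⟨v, mem_openCluster_self ω v⟩ h,
    fun v u ω _ hne h => by rw [KNPreFKG.openCluster_eq_of_reachable (((openGraph_adj ω v u).2 ⟨h, hne⟩).reachable)]⟩

end Summit.CriticalPhenomena.PercolationContinuityZ3.Theorems

end
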